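import Mathlib
import HarnessLib

/-!
# `OffTetraSectorKernel` (stmt-KontsevichZagierPeriods-10557) — line `odd-hyperbolic-ladder` (skeleton v3b),
finite-vertex reduction: exit points and row permutations in the paraboloid lift

Lead c2. In the paraboloid lift `Ql p = (|p|², p₀, p₁, 1)` of the upper half space the quadratic form is
`Φ x = x₁² + x₂² − x₀x₃` (null rows = ideal points, `Φ (Ql q) = −q₂²`), with pairing
`B(x, Ql q) = x₁q₀ + x₂q₁ − (x₀ + x₃|q|²)/2`. This file proves: a null vector pairing negatively with a lift is in
the FUTURE nappe (`redAux_future_of_pair_neg`); the EXIT POINT of the geodesic from a finite vertex `q'` through a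
finite vertex `q` (`redAux_exit_timelike`, registered sub-goal: `Ql q = α • Ql q' + u`, `α > 0`, `u` null future with
algebraic entries — the smaller root of `q₂'²α² + 2Bα + q₂² = 0`); and the invariance of the lifted simplex
`Spx v` under row permutations (`redAux_spx_perm`). No definitions.

References: J. L. Dupont, C.-H. Sah, *Scissors congruences II*, J. Pure Appl. Algebra 25 (1982), §3.
-/

noncomputable section

open Set

namespace Summit.KontsevichZagierPeriods.HyperbolicBloch.OffTetraSectorKernel

/-- For a null vector `x` (`x₁² + x₂² = x₀x₃`) in the PAST nappe (`x₃ < 0`), the pairing with the lift of a point `q` of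
the upper half space, `B(x, Ql q) = x₁q₀ + x₂q₁ − (x₀ + x₃|q|²)/2`, is positive. [folklore] -/
theorem redAux_pair_pos_of_past (q : Fin 3 → ℝ) (hq : 0 < q 2) {x : Fin 4 → ℝ}
    (hx : x 1 ^ 2 + x 2 ^ 2 = x 0 * x 3) (h3 : x 3 < 0) :
    0 < x 1 * q 0 + x 2 * q 1 - (x 0 + x 3 * (q 0 ^ 2 + q 1 ^ 2 + q 2 ^ 2)) / 2 := by
  -- 2 (−x₃) · pairing = (x₁ − x₃q₀)² + (x₂ − x₃q₁)² + x₃² q₂²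
  have key : 2 * (-x 3) * (x 1 * q 0 + x 2 * q 1 - (x 0 + x 3 * (q 0 ^ 2 + q 1 ^ 2 + q 2 ^ 2)) / 2) =
      (x 1 - x 3 * q 0) ^ 2 + (x 2 - x 3 * q 1) ^ 2 + x 3 ^ 2 * q 2 ^ 2 := by
    linear_combination -hx
  have hpos : 0 < (x 1 - x 3 * q 0) ^ 2 + (x 2 - x 3 * q 1) ^ 2 + x 3 ^ 2 * q 2 ^ 2 := by
    have hx3 : 0 < x 3 ^ 2 := by simpa [neg_sq] using pow_pos (neg_pos.mpr h3) 2
    have : 0 < x 3 ^ 2 * q 2 ^ 2 := mul_pos hx3 (by positivity)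
    positivity
  rw [← key] at hpos
  have h3' : 0 < 2 * (-x 3) := by linarith
  exact (mul_pos_iff_of_pos_left h3').mp hpos

/-- Hence a non-zero null vector pairing NEGATIVELY with the lift of a half-space point is in the future nappe:
`x₃ ≥ 0` and `x₀ + x₃ > 0`. [folklore] -/
theorem redAux_future_of_pair_neg (q : Fin 3 → ℝ) (hq : 0 < q 2) {x : Fin 4 → ℝ}
    (hx : x 1 ^ 2 + x 2 ^ 2 = x 0 * x 3)
    (hB : x 1 * q 0 + x 2 * q 1 - (x 0 + x 3 * (q 0 ^ 2 + q 1 ^ 2 + q 2 ^ 2)) / 2 < 0) :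
    0 ≤ x 3 ∧ 0 < x 0 + x 3 := by
  have h3 : 0 ≤ x 3 := by
    by_contra h
    push Not at h
    exact absurd hB (not_lt.mpr (redAux_pair_pos_of_past q hq hx h).le)
  refine ⟨h3, ?_⟩
  rcases h3.lt_or_eq with h3' | h3'
  · have hx0 : 0 ≤ x 0 := by
      by_contra h
      push Not at h
      have : x 0 * x 3 < 0 := mul_neg_of_neg_of_pos h h3'
      nlinarith [sq_nonneg (x 1), sq_nonneg (x 2)]
    linarith
  · have h0 : x 1 ^ 2 + x 2 ^ 2 = 0 := by rw [hx, ← h3', mul_zero]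
    have hx1 : x 1 = 0 := by nlinarith [sq_nonneg (x 1), sq_nonneg (x 2)]
    have hx2 : x 2 = 0 := by nlinarith [sq_nonneg (x 1), sq_nonneg (x 2)]
    rw [hx1, hx2, ← h3'] at hB
    have hx0 : 0 < x 0 := by linarith
    by_contra hcon
    push Not at hcon
    rw [← h3'] at hcon
    linarith

/-- The pairing of a null FUTURE row with the lift of a half-space point is negative. [folklore] -/
theorem redAux_pair_neg_of_future (q : Fin 3 → ℝ) (hq : 0 < q 2) {n : Fin 4 → ℝ}
    (hn : n 1 ^ 2 + n 2 ^ 2 = n 0 * n 3 ∧ 0 ≤ n 3 ∧ 0 < n 0 + n 3) :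
    n 1 * q 0 + n 2 * q 1 - (n 0 + n 3 * (q 0 ^ 2 + q 1 ^ 2 + q 2 ^ 2)) / 2 < 0 := by
  obtain ⟨h1, h2, h3⟩ := hn
  rcases h2.lt_or_eq with h2' | h2'
  · have key : 2 * n 3 * (n 1 * q 0 + n 2 * q 1 - (n 0 + n 3 * (q 0 ^ 2 + q 1 ^ 2 + q 2 ^ 2)) / 2) =
        -((n 3 * q 0 - n 1) ^ 2 + (n 3 * q 1 - n 2) ^ 2 + n 3 ^ 2 * q 2 ^ 2) := by
      linear_combination h1
    have hpos : 0 < (n 3 * q 0 - n 1) ^ 2 + (n 3 * q 1 - n 2) ^ 2 + n 3 ^ 2 * q 2 ^ 2 := by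
      have : 0 < n 3 ^ 2 * q 2 ^ 2 := mul_pos (pow_pos h2' 2) (by positivity)
      positivity
    have hneg : 2 * n 3 * (n 1 * q 0 + n 2 * q 1 - (n 0 + n 3 * (q 0 ^ 2 + q 1 ^ 2 + q 2 ^ 2)) / 2) < 0 := by
      rw [key]; linarith
    have h3pos : 0 < 2 * n 3 := by linarith
    by_contra hcon
    push Not at hcon
    have := mul_nonneg h3pos.le hcon
    linarith
  · have h0 : n 1 ^ 2 + n 2 ^ 2 = 0 := by rw [h1, ← h2', mul_zero]
    have hn1 : n 1 = 0 := by nlinarith [sq_nonneg (n 1), sq_nonneg (n 2)]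
    have hn2 : n 2 = 0 := by nlinarith [sq_nonneg (n 1), sq_nonneg (n 2)]
    rw [hn1, hn2, ← h2']
    have : 0 < n 0 := by linarith
    linarith

/-- Square roots of non-negative real algebraic numbers are algebraic. [folklore] -/
theorem redAux_isAlgebraic_sqrt {x : ℝ} (hx : IsAlgebraic ℚ x) (h0 : 0 ≤ x) : IsAlgebraic ℚ (Real.sqrt x) := by
  refine IsAlgebraic.of_pow (n := 2) two_pos ?_
  rw [Real.sq_sqrt h0]
  exact hx

/-- EXIT POINT through a finite vertex: for the lifts `Ql q`, `Ql q'` of two distinct points of the upper half space there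
are `α > 0` and a null future vector `u` with real-algebraic entries (when `q`, `q'` are algebraic) such that
`Ql q = α • Ql q' + 1 • u`: the geodesic from `q'` through `q` exits at the ideal point lifted by `u`. [folklore] -/
theorem redAux_exit_timelike :
    ∀ (Ql : (Fin 3 → ℝ) → Fin 4 → ℝ)
    (hQl : ∀ p, Ql p = ![p 0 ^ 2 + p 1 ^ 2 + p 2 ^ 2, p 0, p 1, 1]) (q q' : Fin 3 → ℝ) (hq : 0 < q 2)
    (hq' : 0 < q' 2) (hne : q ≠ q') (halg : ∀ i, IsAlgebraic ℚ (q i)) (halg' : ∀ i, IsAlgebraic ℚ (q' i)),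
    ∃ (α : ℝ) (u : Fin 4 → ℝ), 0 < α ∧ Ql q = α • Ql q' + (1 : ℝ) • u ∧
      (u 1 ^ 2 + u 2 ^ 2 = u 0 * u 3 ∧ 0 ≤ u 3 ∧ 0 < u 0 + u 3) ∧ (∀ k, IsAlgebraic ℚ (u k)) := by
  intro Ql hQl q q' hq hq' hne halg halg'
  -- the pairing B = B(Ql q, Ql q') = -[(q₀-q₀')² + (q₁-q₁')² + q₂² + q₂'²]/2 < 0 and the discriminant Δ
  obtain ⟨B, hB⟩ : ∃ B : ℝ, B = q 0 * q' 0 + q 1 * q' 1 -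
      ((q 0 ^ 2 + q 1 ^ 2 + q 2 ^ 2) + (q' 0 ^ 2 + q' 1 ^ 2 + q' 2 ^ 2)) / 2 := ⟨_, rfl⟩
  have hBneg : B < 0 := by
    have e : B = -((q 0 - q' 0) ^ 2 + (q 1 - q' 1) ^ 2 + q 2 ^ 2 + q' 2 ^ 2) / 2 := by rw [hB]; ring
    have : 0 < (q 0 - q' 0) ^ 2 + (q 1 - q' 1) ^ 2 + q 2 ^ 2 + q' 2 ^ 2 := by positivity
    rw [e]; linarith
  obtain ⟨Δ, hΔ⟩ : ∃ Δ : ℝ, Δ = B ^ 2 - q 2 ^ 2 * q' 2 ^ 2 := ⟨_, rfl⟩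
  have hΔfac : 4 * Δ = ((q 0 - q' 0) ^ 2 + (q 1 - q' 1) ^ 2 + (q 2 - q' 2) ^ 2) *
      ((q 0 - q' 0) ^ 2 + (q 1 - q' 1) ^ 2 + (q 2 + q' 2) ^ 2) := by
    rw [hΔ, hB]; ring
  have hd : 0 < (q 0 - q' 0) ^ 2 + (q 1 - q' 1) ^ 2 + (q 2 - q' 2) ^ 2 := by
    by_contra h
    have hS : (q 0 - q' 0) ^ 2 + (q 1 - q' 1) ^ 2 + (q 2 - q' 2) ^ 2 = 0 :=
      le_antisymm (not_lt.mp h) (by positivity)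
    have h0 : (q 0 - q' 0) ^ 2 = 0 := by
      apply le_antisymm _ (sq_nonneg _); nlinarith [sq_nonneg (q 1 - q' 1), sq_nonneg (q 2 - q' 2)]
    have h1 : (q 1 - q' 1) ^ 2 = 0 := by
      apply le_antisymm _ (sq_nonneg _); nlinarith [sq_nonneg (q 0 - q' 0), sq_nonneg (q 2 - q' 2)]
    have h2 : (q 2 - q' 2) ^ 2 = 0 := by
      apply le_antisymm _ (sq_nonneg _); nlinarith [sq_nonneg (q 0 - q' 0), sq_nonneg (q 1 - q' 1)]
    apply hne
    ext i
    fin_cases i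
    · exact sub_eq_zero.mp (pow_eq_zero_iff two_ne_zero |>.mp h0)
    · exact sub_eq_zero.mp (pow_eq_zero_iff two_ne_zero |>.mp h1)
    · exact sub_eq_zero.mp (pow_eq_zero_iff two_ne_zero |>.mp h2)
  have he : 0 < (q 0 - q' 0) ^ 2 + (q 1 - q' 1) ^ 2 + (q 2 + q' 2) ^ 2 := by
    have hq22 : 0 < q 2 + q' 2 := by linarith
    positivity
  have hΔpos : 0 < Δ := by
    have := mul_pos hd he
    linarith
  obtain ⟨s, hs⟩ : ∃ s : ℝ, s = Real.sqrt Δ := ⟨_, rfl⟩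
  have hs0 : 0 < s := by rw [hs]; exact Real.sqrt_pos.mpr hΔpos
  have hss : s ^ 2 = Δ := by rw [hs]; exact Real.sq_sqrt hΔpos.le
  -- s < -B since s² = B² - q₂²q₂'² < B²
  have hsB : s < -B := by
    by_contra h
    push Not at h
    have : B ^ 2 ≤ s ^ 2 := by nlinarith [h, hBneg]
    have hqq : 0 < q 2 ^ 2 * q' 2 ^ 2 := mul_pos (pow_pos hq 2) (pow_pos hq' 2)
    linarith [hss, hΔ ▸ hss]
  obtain ⟨α, hα⟩ : ∃ α : ℝ, α = (-B - s) / q' 2 ^ 2 := ⟨_, rfl⟩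
  have hq'2 : q' 2 ^ 2 ≠ 0 := pow_ne_zero 2 hq'.ne'
  have h1 : α * q' 2 ^ 2 = -B - s := by rw [hα]; field_simp
  have hαpos : 0 < α := by rw [hα]; exact div_pos (by linarith) (pow_pos hq' 2)
  have h2 : s ^ 2 = B ^ 2 - q 2 ^ 2 * q' 2 ^ 2 := by rw [hss, hΔ]
  -- α is the smaller root of q₂'² α² + 2 B α + q₂² = 0
  have hroot : q' 2 ^ 2 * α ^ 2 + 2 * B * α + q 2 ^ 2 = 0 := by
    have hmul : (q' 2 ^ 2 * α ^ 2 + 2 * B * α + q 2 ^ 2) * q' 2 ^ 2 = 0 := by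
      linear_combination (α * q' 2 ^ 2 + B - s) * h1 + h2
    exact (mul_eq_zero.mp hmul).resolve_right hq'2
  -- and α (-B) < q₂²
  have hαlt : α * (-B) < q 2 ^ 2 := by
    have key3 : α * (-B) * q' 2 ^ 2 = B ^ 2 + B * s := by linear_combination (-B) * h1
    have h4 : s * (s + B) < 0 := mul_neg_of_pos_of_neg hs0 (by linarith)
    have h5 : s * (s + B) = s ^ 2 + B * s := by ring
    have hlt : α * (-B) * q' 2 ^ 2 < q 2 ^ 2 * q' 2 ^ 2 := by
      rw [key3]; nlinarith [h2, h4, h5]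
    exact lt_of_mul_lt_mul_right hlt (pow_pos hq' 2).le
  -- the exit vector
  obtain ⟨u, hu⟩ : ∃ u : Fin 4 → ℝ, u = Ql q - α • Ql q' := ⟨_, rfl⟩
  have huk : ∀ k, u k = Ql q k - α * Ql q' k := fun k => by simp [hu]
  have e0 : Ql q 0 = q 0 ^ 2 + q 1 ^ 2 + q 2 ^ 2 := by rw [hQl]; simp
  have e1 : Ql q 1 = q 0 := by rw [hQl]; simp
  have e2 : Ql q 2 = q 1 := by rw [hQl]; simp
  have e3 : Ql q 3 = 1 := by rw [hQl]; simp
  have f0 : Ql q' 0 = q' 0 ^ 2 + q' 1 ^ 2 + q' 2 ^ 2 := by rw [hQl]; simp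
  have f1 : Ql q' 1 = q' 0 := by rw [hQl]; simp
  have f2 : Ql q' 2 = q' 1 := by rw [hQl]; simp
  have f3 : Ql q' 3 = 1 := by rw [hQl]; simp
  refine ⟨α, u, hαpos, ?_, ?_, ?_⟩
  · rw [one_smul, hu]; abel
  · have expand : u 1 ^ 2 + u 2 ^ 2 - u 0 * u 3 = -(q 2 ^ 2) - 2 * α * B + α ^ 2 * (-(q' 2 ^ 2)) := by
      rw [huk, huk, huk, huk, e0, e1, e2, e3, f0, f1, f2, f3, hB]; ring
    have hnull : u 1 ^ 2 + u 2 ^ 2 = u 0 * u 3 := by linear_combination expand - hroot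
    have hpair : u 1 * q 0 + u 2 * q 1 - (u 0 + u 3 * (q 0 ^ 2 + q 1 ^ 2 + q 2 ^ 2)) / 2 < 0 := by
      have e : u 1 * q 0 + u 2 * q 1 - (u 0 + u 3 * (q 0 ^ 2 + q 1 ^ 2 + q 2 ^ 2)) / 2 = -(q 2 ^ 2) - α * B := by
        rw [huk, huk, huk, huk, e0, e1, e2, e3, f0, f1, f2, f3, hB]; ring
      rw [e]; linarith
    exact ⟨hnull, redAux_future_of_pair_neg q hq hnull hpair⟩
  · -- algebraicity
    have h2a : IsAlgebraic ℚ (2 : ℝ) := by simpa using isAlgebraic_algebraMap (R := ℚ) (A := ℝ) (2 : ℚ)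
    have hBalg : IsAlgebraic ℚ B := by
      rw [hB, div_eq_mul_inv]
      exact (((halg 0).mul (halg' 0)).add ((halg 1).mul (halg' 1))).sub
        ((((((halg 0).pow 2).add ((halg 1).pow 2)).add ((halg 2).pow 2)).add
          ((((halg' 0).pow 2).add ((halg' 1).pow 2)).add ((halg' 2).pow 2))).mul h2a.inv)
    have hΔalg : IsAlgebraic ℚ Δ := by rw [hΔ]; exact (hBalg.pow 2).sub (((halg 2).pow 2).mul ((halg' 2).pow 2))
    have hsalg : IsAlgebraic ℚ s := by rw [hs]; exact redAux_isAlgebraic_sqrt hΔalg hΔpos.le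
    have hαalg : IsAlgebraic ℚ α := by
      rw [hα, div_eq_mul_inv]
      exact (hBalg.neg.sub hsalg).mul ((halg' 2).pow 2).inv
    intro k
    rw [huk]
    have hQa : ∀ (p : Fin 3 → ℝ), (∀ i, IsAlgebraic ℚ (p i)) → ∀ k, IsAlgebraic ℚ (Ql p k) := by
      intro p hp k
      rw [hQl]
      fin_cases k
      · simpa using (((hp 0).pow 2).add ((hp 1).pow 2)).add ((hp 2).pow 2)
      · simpa using hp 0
      · simpa using hp 1
      · simpa using isAlgebraic_one
    exact (hQa q halg k).sub (hαalg.mul (hQa q' halg' k))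

/-! ### Row permutations do not change the lifted simplex -/

/-- Permuting the vertex rows does not change the simplex. [folklore] -/
theorem redAux_spx_perm (Ql : (Fin 3 → ℝ) → Fin 4 → ℝ)
    (Spx : (Fin 4 → Fin 4 → ℝ) → Set (Fin 3 → ℝ))
    (hSpx : ∀ v, Spx v = {p | 0 < p 2 ∧ ∀ a, 0 < (Matrix.of v).det * ((Matrix.of v).updateRow a (Ql p)).det})
    (σ : Equiv.Perm (Fin 4)) (v : Fin 4 → Fin 4 → ℝ) : Spx (v ∘ σ) = Spx v := by
  have hdet : (Matrix.of (v ∘ σ)).det = Equiv.Perm.sign σ * (Matrix.of v).det := by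
    have : Matrix.of (v ∘ σ) = (Matrix.of v).submatrix σ id := by ext i j; rfl
    rw [this, Matrix.det_permute]
  have hupd : ∀ (a : Fin 4) (Q : Fin 4 → ℝ),
      (Matrix.of (v ∘ σ)).updateRow a Q = ((Matrix.of v).updateRow (σ a) Q).submatrix σ id := by
    intro a Q
    ext b j
    simp only [Matrix.updateRow_apply, Matrix.submatrix_apply, id_eq, Matrix.of_apply, Function.comp_apply,
      σ.injective.eq_iff]
  have hE : ∀ (a : Fin 4) (Q : Fin 4 → ℝ),
      ((Matrix.of (v ∘ σ)).updateRow a Q).det = Equiv.Perm.sign σ * ((Matrix.of v).updateRow (σ a) Q).det := by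
    intro a Q; rw [hupd, Matrix.det_permute]
  have hsq : ((Equiv.Perm.sign σ : ℤ) : ℝ) * ((Equiv.Perm.sign σ : ℤ) : ℝ) = 1 := by
    rcases Int.units_eq_one_or (Equiv.Perm.sign σ) with h | h <;> simp [h]
  ext p
  rw [hSpx, hSpx]
  simp only [Set.mem_setOf_eq]
  refine and_congr Iff.rfl ⟨fun h a => ?_, fun h a => ?_⟩
  · have := h (σ.symm a)
    rw [hdet, hE, Equiv.apply_symm_apply] at this
    have e : ↑↑(Equiv.Perm.sign σ) * (Matrix.of v).det * (↑↑(Equiv.Perm.sign σ) * ((Matrix.of v).updateRow a (Ql p)).det)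
        = (↑↑(Equiv.Perm.sign σ) * ↑↑(Equiv.Perm.sign σ)) * ((Matrix.of v).det * ((Matrix.of v).updateRow a (Ql p)).det) := by
      ring
    rw [e, hsq, one_mul] at this
    exact this
  · have := h (σ a)
    rw [hdet, hE]
    have e : ↑↑(Equiv.Perm.sign σ) * (Matrix.of v).det * (↑↑(Equiv.Perm.sign σ) * ((Matrix.of v).updateRow (σ a) (Ql p)).det)
        = (↑↑(Equiv.Perm.sign σ) * ↑↑(Equiv.Perm.sign σ)) * ((Matrix.of v).det * ((Matrix.of v).updateRow (σ a) (Ql p)).det) := by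
      ring
    rw [e, hsq, one_mul]
    exact this



end Summit.KontsevichZagierPeriods.HyperbolicBloch.OffTetraSectorKernel

end
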